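import Literature.NumberTheory.Transcendental.PhilipponCriterionStep
import HarnessLib

/-!
# Philippon's criterion over Nesterenko's toolkit, XV: the induction `(A_{r₀}) ⇒ … ⇒ (A_1)` — proofs only

`Literature/NumberTheory/Transcendental/PhilipponCriterionInduction.lean` — proofs only (no new
definitions, nothing asserted). The descending induction of Philippon's proof of Théorème 2.11
(Publ. Math. IHÉS 64 (1986), §3, p. 42: "Nous allons montrer que l'assertion `(A_{k+1})` est vraie
puis que pour `n + 1 ≥ r > 1`, `(A_r)` entraîne `(A_{r−1})`; nous en déduirons que `(A_1)` est
vraie") at a fixed large level `N`, for the assertion `Setup.Good` with the geometric sequence of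
quality constants `λ_r = q^{r₀−r}`:

* `Setup.B_antitone`, `Setup.Λ_ge` — `B_r ≤ B_1` and `Λ_r(N) ≥ λ C ξ(N)` (as `g = C ξ^{k+1}`);
* `Setup.iabs_𝔓₀_eq_zero` — `|𝔓₀(ω̄)| = 0` (Cor. 4.10 with `ρ_ω̄(𝔓₀) = 0`; Lemme 2.13);
* `Setup.good_iter` — for every `j < r₀` a prime satisfying `(A_{r₀−j})` at level `N` with quality
  `q^j`, under the largeness hypotheses on `C` (in terms of `n, k, θ`) and `N`;
* `Setup.good_one` — in particular `(A_1)` at every large level `N`.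

## References

* [Philippon1986Criteres] P. Philippon, Publ. Math. IHÉS 64 (1986), §3, Lemmes 2.13–2.14 (pp. 42–45).
* [NesterenkoPhilippon2001] LNM 1752 (2001), Ch. 3 Cor. 4.10 (p. 40).
-/

noncomputable section

open MvPolynomial Real
open Literature.NumberTheory.Transcendental.Nesterenko

attribute [local instance] MvPolynomial.gradedAlgebra

namespace Literature.NumberTheory.Transcendental

namespace PhilipponMain

namespace Setup

variable (𝒮 : Setup)

/-! ### Two more bookkeeping facts -/

/-- `B_r` is non-increasing in `r`. [folklore] -/
theorem B_antitone {r r' : ℕ} (h : r ≤ r') : 𝒮.B r' ≤ 𝒮.B r := by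
  unfold B
  have hD : (0 : ℝ) ≤ 𝒮.D₀ := Nat.cast_nonneg _
  have hcB : 0 ≤ 𝒮.cB := le_trans zero_le_one 𝒮.one_le_cB
  have h1 : ((𝒮.r₀ - r' : ℕ) : ℝ) ≤ ((𝒮.r₀ - r : ℕ) : ℝ) := by exact_mod_cast Nat.sub_le_sub_left h _
  nlinarith [mul_nonneg hD hcB]

/-- `Λ_r(N) ≥ λ C ξ(N)` for `0 ≤ λ`, `1 ≤ r ≤ r₀` (since `g = C ξ^{k+1}`, `r₀ ≤ k + 1`, `δ, ξ ≥ 1`).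
[cite: Philippon1986Criteres, §3 p. 42] -/
theorem Λ_ge {lam : ℝ} (hlam : 0 ≤ lam) {r : ℕ} (hr1 : 1 ≤ r) (hrr : r ≤ 𝒮.r₀) (N : ℕ) :
    lam * 𝒮.C * 𝒮.ξ N ≤ 𝒮.Λ lam r N := by
  unfold Λ
  have hξ := 𝒮.ξ_pos N
  have hξ1 := 𝒮.one_le_ξ N
  have hδ1 := 𝒮.one_le_δ N
  have hC := 𝒮.C_pos
  have hg := 𝒮.g_pos N
  rw [le_div_iff₀ (by positivity)]
  -- `ξ · ξ^{r₀−r} ≤ ξ^{k+1} = g/C`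
  have h1 : 𝒮.ξ N * 𝒮.ξ N ^ (𝒮.r₀ - r) ≤ 𝒮.g N / 𝒮.C := by
    rw [← 𝒮.ξ_pow N, ← pow_succ']
    exact pow_le_pow_right₀ hξ1 (by have := 𝒮.r₀_le; omega)
  have h2 : lam * 𝒮.C * (𝒮.ξ N * 𝒮.ξ N ^ (𝒮.r₀ - r)) ≤ lam * 𝒮.C * (𝒮.g N / 𝒮.C) :=
    mul_le_mul_of_nonneg_left h1 (by positivity)
  have h3 : lam * 𝒮.C * (𝒮.g N / 𝒮.C) = lam * 𝒮.g N := by field_simp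
  have h4 : lam * 𝒮.g N ≤ lam * 𝒮.g N * 𝒮.δ N ^ (r - 1) :=
    le_mul_of_one_le_right (by positivity) (one_le_pow₀ hδ1)
  calc lam * 𝒮.C * 𝒮.ξ N * 𝒮.ξ N ^ (𝒮.r₀ - r) = lam * 𝒮.C * (𝒮.ξ N * 𝒮.ξ N ^ (𝒮.r₀ - r)) := by ring
    _ ≤ lam * 𝒮.g N := by rw [← h3]; exact h2
    _ ≤ lam * 𝒮.g N * 𝒮.δ N ^ (r - 1) := h4

/-- **Lemme 2.13** input: `|𝔓₀(ω̄)| = 0`, from Cor. 4.10 (`|𝔓₀(ω̄)| ≤ ρ_ω̄(𝔓₀) e^{5m² deg}`) and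
`ρ_ω̄(𝔓₀) = 0` (`ω̄ ∈ V(𝔓₀)`), when `r₀ ≤ m`. [cite: Philippon1986Criteres, §3 Lemme 2.13 (p. 42)]
[cite: NesterenkoPhilippon2001, Ch. 3 Cor. 4.10 (p. 40)] -/
theorem iabs_𝔓₀_eq_zero (h410 : NesterenkoPhilippon2001_ch3_cor_4_10) (hr₀m : 𝒮.r₀ ≤ 𝒮.m) :
    iabs 𝒮.𝔓₀ 𝒮.r₀ 𝒮.ω = 0 := by
  have h := h410 𝒮.m 𝒮.r₀ 𝒮.𝔓₀ 𝒮.one_le_r₀ hr₀m 𝒮.isPrime_𝔓₀ 𝒮.isHomogeneous_𝔓₀ 𝒮.rank_𝔓₀ 𝒮.ω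
    𝒮.ω_ne_zero
  rw [𝒮.rho_𝔓₀, zero_mul] at h
  exact le_antisymm h (iabs_nonneg _ _ _)

/-! ### The induction -/

/-- One step of the induction with the geometric quality constants `λ = q^j`, `λ' = q^{j+1}`:
the hypotheses of `Setup.step` at rank `r = r₀ − j ≥ 2` follow from `Λ_r(N) ≥ q^{r₀−1} C ξ(N)` and
the stated largeness of `C`, `N`. [cite: Philippon1986Criteres, §3 Lemme 2.14 (pp. 43–45)] -/
theorem good_succ (h44 : NesterenkoPhilippon2001_ch3_prop_4_4)
    (h47 : NesterenkoPhilippon2001_ch3_prop_4_7)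
    (h411 : NesterenkoPhilippon2001_ch3_prop_4_11) (h412 : NesterenkoPhilippon2001_ch3_cor_4_12)
    (h413 : NesterenkoPhilippon2001_ch3_prop_4_13) (hr₀m : 𝒮.r₀ ≤ 𝒮.m) {N : ℕ} (hN : 𝒮.N₀ ≤ N)
    {q : ℝ} (hq0 : 0 < q) (hq1 : q ≤ 1)
    (hqc : 20 * ((1 + (𝒮.m : ℝ) ^ 2) * (2 + 𝒮.m * (𝒮.k + 3))) * q * (1 + 𝒮.B 1 + 𝒮.D₀) ≤ 1)
    (hC1 : 2 + 8 * 𝒮.r₀ * (𝒮.m : ℝ) ^ 3 ≤ q ^ (𝒮.r₀ - 1) * 𝒮.C)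
    (hC2 : 2 * (1 + 11 * (𝒮.m : ℝ) ^ 2) ≤ q ^ (𝒮.r₀ - 1) * 𝒮.C)
    (hC3 : 10 * (1 + 12 * (𝒮.m : ℝ) ^ 2) ≤ q ^ (𝒮.r₀ - 1) * 𝒮.C)
    (hC4 : 20 * (𝒮.m : ℝ) ^ 3 ≤ q ^ (𝒮.r₀ - 1) * 𝒮.C)
    (hCa : 2 * (1 + 11 * (𝒮.m : ℝ) ^ 2) * (𝒮.B 1 + 𝒮.D₀) ≤ 𝒮.C) (hCb : 2 * (𝒮.m : ℝ) ≤ 𝒮.C)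
    (hCc : log (4 * 𝒮.Θ ^ 2) ≤ 𝒮.C) (hCd : 20 * (𝒮.m : ℝ) ^ 3 * 𝒮.D₀ ≤ 𝒮.C)
    (hNbig : 𝒮.R 𝒮.N₀ + log (1 / 𝒮.κ) < q ^ (𝒮.r₀ - 1) * 𝒮.C * 𝒮.τ N / (2 * 𝒮.r₀))
    {j : ℕ} (hj : j + 1 < 𝒮.r₀) {𝔓 : Ideal (Rx 𝒮.m)} (hgood : 𝒮.Good (q ^ j) N (𝒮.r₀ - j) 𝔓) :
    ∃ 𝔮 : Ideal (Rx 𝒮.m), 𝒮.Good (q ^ (j + 1)) N (𝒮.r₀ - (j + 1)) 𝔮 := by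
  set c : ℝ := 20 * ((1 + (𝒮.m : ℝ) ^ 2) * (2 + 𝒮.m * (𝒮.k + 3))) with hcdef
  have hm0 : (0 : ℝ) ≤ 𝒮.m := Nat.cast_nonneg _
  have hc0 : 0 ≤ c := by positivity
  have hD : (0 : ℝ) ≤ 𝒮.D₀ := Nat.cast_nonneg _
  have hB1 := 𝒮.B_nonneg 1
  have hC := 𝒮.C_pos
  have hcq : c * q ≤ 1 := by
    have h1 : c * q ≤ c * q * (1 + 𝒮.B 1 + 𝒮.D₀) :=
      le_mul_of_one_le_right (by positivity) (by linarith)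
    exact h1.trans hqc
  -- the current rank `r = r₀ − j ≥ 2` and the quality constants `λ = q^j ≥ q^{r₀−1}`, `λ' = q^{j+1}`
  have hr2 : 2 ≤ 𝒮.r₀ - j := by omega
  have hrr : 𝒮.r₀ - j ≤ 𝒮.r₀ := Nat.sub_le _ _
  have hrm : 𝒮.r₀ - j ≤ 𝒮.m := hrr.trans hr₀m
  have hr1 : 1 ≤ 𝒮.r₀ - j := by omega
  have hqj0 : 0 ≤ q ^ j := by positivity
  have hqj1 : q ^ j ≤ 1 := pow_le_one₀ hq0.le hq1
  have hqjr : q ^ (𝒮.r₀ - 1) ≤ q ^ j := pow_le_pow_of_le_one hq0.le hq1 (by omega)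
  have hξ1 := 𝒮.one_le_ξ N
  have hξ0 := (𝒮.ξ_pos N).le
  -- `Λ ≥ q^{r₀−1} C ξ ≥ q^{r₀−1} C`
  set L : ℝ := 𝒮.Λ (q ^ j) (𝒮.r₀ - j) N with hLdef
  have hΛ1 : q ^ (𝒮.r₀ - 1) * 𝒮.C * 𝒮.ξ N ≤ L :=
    le_trans (mul_le_mul_of_nonneg_right (mul_le_mul_of_nonneg_right hqjr hC.le) hξ0)
      (𝒮.Λ_ge hqj0 hr1 hrr N)
  have hΛ2 : q ^ (𝒮.r₀ - 1) * 𝒮.C ≤ L := le_trans (le_mul_of_one_le_right (by positivity) hξ1) hΛ1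
  have hrR : ((𝒮.r₀ - j : ℕ) : ℝ) ≤ 𝒮.r₀ := by exact_mod_cast hrr
  have hBr : 𝒮.B (𝒮.r₀ - j) ≤ 𝒮.B 1 := 𝒮.B_antitone hr1
  -- the hypotheses of `step`
  have hlam'a : c * q ^ (j + 1) ≤ q ^ j := by
    have e : c * q ^ (j + 1) = (c * q) * q ^ j := by ring
    rw [e]
    exact le_trans (mul_le_mul_of_nonneg_right hcq hqj0) (by rw [one_mul])
  have hlam'b : c * q ^ (j + 1) * (𝒮.B (𝒮.r₀ - j) + 𝒮.D₀) ≤ 1 := by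
    have e : c * q ^ (j + 1) * (𝒮.B (𝒮.r₀ - j) + 𝒮.D₀) =
        q ^ j * (c * q * (𝒮.B (𝒮.r₀ - j) + 𝒮.D₀)) := by ring
    rw [e]
    have h2 : c * q * (𝒮.B (𝒮.r₀ - j) + 𝒮.D₀) ≤ c * q * (1 + 𝒮.B 1 + 𝒮.D₀) :=
      mul_le_mul_of_nonneg_left (by linarith) (by positivity)
    have h3 : 0 ≤ c * q * (1 + 𝒮.B 1 + 𝒮.D₀) := by positivity
    calc q ^ j * (c * q * (𝒮.B (𝒮.r₀ - j) + 𝒮.D₀)) ≤ q ^ j * (c * q * (1 + 𝒮.B 1 + 𝒮.D₀)) :=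
          mul_le_mul_of_nonneg_left h2 hqj0
      _ ≤ 1 * (c * q * (1 + 𝒮.B 1 + 𝒮.D₀)) := mul_le_mul_of_nonneg_right hqj1 h3
      _ ≤ 1 := by rw [one_mul]; exact hqc
  have hΛa : 2 + 8 * ((𝒮.r₀ - j : ℕ) : ℝ) * (𝒮.m : ℝ) ^ 3 ≤ L := by
    have h1 : 8 * ((𝒮.r₀ - j : ℕ) : ℝ) * (𝒮.m : ℝ) ^ 3 ≤ 8 * 𝒮.r₀ * (𝒮.m : ℝ) ^ 3 := by
      have := mul_le_mul_of_nonneg_right hrR (by positivity : (0 : ℝ) ≤ 8 * (𝒮.m : ℝ) ^ 3)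
      linarith
    linarith
  have hΛb : 2 * (1 + 11 * (𝒮.m : ℝ) ^ 2) ≤ L := hC2.trans hΛ2
  have hΛc : 10 * (1 + 12 * (𝒮.m : ℝ) ^ 2) * 𝒮.ξ N ≤ L :=
    le_trans (mul_le_mul_of_nonneg_right hC3 hξ0) hΛ1
  have hΛd : 20 * (𝒮.m : ℝ) ^ 3 * 𝒮.ξ N ≤ L := le_trans (mul_le_mul_of_nonneg_right hC4 hξ0) hΛ1
  have hCa' : 2 * (1 + 11 * (𝒮.m : ℝ) ^ 2) * (𝒮.B (𝒮.r₀ - j) + 𝒮.D₀) ≤ 𝒮.C :=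
    le_trans (mul_le_mul_of_nonneg_left (by linarith) (by positivity)) hCa
  have hNbig' : 𝒮.R 𝒮.N₀ + log (1 / 𝒮.κ) < L * 𝒮.τ N / (2 * ((𝒮.r₀ - j : ℕ) : ℝ)) := by
    refine lt_of_lt_of_le hNbig ?_
    have hτ := 𝒮.τ_pos N
    have hr0 : (0 : ℝ) < ((𝒮.r₀ - j : ℕ) : ℝ) := by exact_mod_cast hr1
    have hr₀0 : (0 : ℝ) < 𝒮.r₀ := by exact_mod_cast 𝒮.one_le_r₀
    rw [div_le_div_iff₀ (by positivity) (by positivity)]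
    have h1 : q ^ (𝒮.r₀ - 1) * 𝒮.C * 𝒮.τ N ≤ L * 𝒮.τ N := mul_le_mul_of_nonneg_right hΛ2 hτ.le
    have h2 : 0 ≤ L * 𝒮.τ N := mul_nonneg (𝒮.Λ_nonneg hqj0 _ _) hτ.le
    calc q ^ (𝒮.r₀ - 1) * 𝒮.C * 𝒮.τ N * (2 * ((𝒮.r₀ - j : ℕ) : ℝ))
        ≤ L * 𝒮.τ N * (2 * ((𝒮.r₀ - j : ℕ) : ℝ)) := mul_le_mul_of_nonneg_right h1 (by positivity)
      _ ≤ L * 𝒮.τ N * (2 * 𝒮.r₀) := mul_le_mul_of_nonneg_left (by linarith) h2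
  obtain ⟨𝔮, h𝔮⟩ := 𝒮.step h44 h47 h411 h412 h413 hr2 hrr hrm hN hgood (lam' := q ^ (j + 1))
    (by positivity) hlam'a hlam'b hΛa hΛb hΛc hΛd hCa' hCb hCc hCd hNbig'
  have e : 𝒮.r₀ - j - 1 = 𝒮.r₀ - (j + 1) := by omega
  exact ⟨𝔮, e ▸ h𝔮⟩

/-- **`(A_{r₀}) ⇒ (A_{r₀−1}) ⇒ … ` at a fixed level** (Philippon 1986, §3, Lemmes 2.13–2.14): for
every `j < r₀` there is a prime satisfying `(A_{r₀−j})` at level `N` with quality constant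
`λ = q^j`, where `0 < q ≤ 1`, `c q (1 + B_1 + D₀) ≤ 1` (`c = 20(1+m²)(2+m(k+3))`), provided
`r₀ ≤ m`, `C` is large in terms of `n, k, θ` and `N` is large, as stated.
[cite: Philippon1986Criteres, §3 Lemmes 2.13–2.14 (pp. 42–45)] -/
theorem good_iter (h44 : NesterenkoPhilippon2001_ch3_prop_4_4)
    (h47 : NesterenkoPhilippon2001_ch3_prop_4_7) (h410 : NesterenkoPhilippon2001_ch3_cor_4_10)
    (h411 : NesterenkoPhilippon2001_ch3_prop_4_11) (h412 : NesterenkoPhilippon2001_ch3_cor_4_12)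
    (h413 : NesterenkoPhilippon2001_ch3_prop_4_13) (hr₀m : 𝒮.r₀ ≤ 𝒮.m) {N : ℕ} (hN : 𝒮.N₀ ≤ N)
    {q : ℝ} (hq0 : 0 < q) (hq1 : q ≤ 1)
    (hqc : 20 * ((1 + (𝒮.m : ℝ) ^ 2) * (2 + 𝒮.m * (𝒮.k + 3))) * q * (1 + 𝒮.B 1 + 𝒮.D₀) ≤ 1)
    (hC1 : 2 + 8 * 𝒮.r₀ * (𝒮.m : ℝ) ^ 3 ≤ q ^ (𝒮.r₀ - 1) * 𝒮.C)
    (hC2 : 2 * (1 + 11 * (𝒮.m : ℝ) ^ 2) ≤ q ^ (𝒮.r₀ - 1) * 𝒮.C)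
    (hC3 : 10 * (1 + 12 * (𝒮.m : ℝ) ^ 2) ≤ q ^ (𝒮.r₀ - 1) * 𝒮.C)
    (hC4 : 20 * (𝒮.m : ℝ) ^ 3 ≤ q ^ (𝒮.r₀ - 1) * 𝒮.C)
    (hCa : 2 * (1 + 11 * (𝒮.m : ℝ) ^ 2) * (𝒮.B 1 + 𝒮.D₀) ≤ 𝒮.C) (hCb : 2 * (𝒮.m : ℝ) ≤ 𝒮.C)
    (hCc : log (4 * 𝒮.Θ ^ 2) ≤ 𝒮.C) (hCd : 20 * (𝒮.m : ℝ) ^ 3 * 𝒮.D₀ ≤ 𝒮.C)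
    (hNbig : 𝒮.R 𝒮.N₀ + log (1 / 𝒮.κ) < q ^ (𝒮.r₀ - 1) * 𝒮.C * 𝒮.τ N / (2 * 𝒮.r₀)) :
    ∀ j : ℕ, j < 𝒮.r₀ → ∃ 𝔓 : Ideal (Rx 𝒮.m), 𝒮.Good (q ^ j) N (𝒮.r₀ - j) 𝔓 := by
  intro j
  induction j with
  | zero =>
    intro _
    exact ⟨𝒮.𝔓₀, by simpa using 𝒮.good_𝔓₀ (lam := 1) N (𝒮.iabs_𝔓₀_eq_zero h410 hr₀m)⟩
  | succ j ih =>
    intro hj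
    obtain ⟨𝔓, hgood⟩ := ih (by omega)
    exact 𝒮.good_succ h44 h47 h411 h412 h413 hr₀m hN hq0 hq1 hqc hC1 hC2 hC3 hC4 hCa hCb hCc hCd
      hNbig hj hgood

/-- **`(A_1)` at every large level** (Philippon 1986, §3, end of the proof of Lemme 2.14, p. 46):
under the hypotheses of `good_iter`, some homogeneous prime `𝔓 ⊇ 𝔓₀` of rank `1` satisfies
`(i)_N`, `(ii)_N` at rank `1` with quality constant `λ_1 = q^{r₀−1}`.
[cite: Philippon1986Criteres, §3 Lemme 2.14 (p. 46)] -/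
theorem good_one (h44 : NesterenkoPhilippon2001_ch3_prop_4_4)
    (h47 : NesterenkoPhilippon2001_ch3_prop_4_7) (h410 : NesterenkoPhilippon2001_ch3_cor_4_10)
    (h411 : NesterenkoPhilippon2001_ch3_prop_4_11) (h412 : NesterenkoPhilippon2001_ch3_cor_4_12)
    (h413 : NesterenkoPhilippon2001_ch3_prop_4_13) (hr₀m : 𝒮.r₀ ≤ 𝒮.m) {N : ℕ} (hN : 𝒮.N₀ ≤ N)
    {q : ℝ} (hq0 : 0 < q) (hq1 : q ≤ 1)
    (hqc : 20 * ((1 + (𝒮.m : ℝ) ^ 2) * (2 + 𝒮.m * (𝒮.k + 3))) * q * (1 + 𝒮.B 1 + 𝒮.D₀) ≤ 1)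
    (hC1 : 2 + 8 * 𝒮.r₀ * (𝒮.m : ℝ) ^ 3 ≤ q ^ (𝒮.r₀ - 1) * 𝒮.C)
    (hC2 : 2 * (1 + 11 * (𝒮.m : ℝ) ^ 2) ≤ q ^ (𝒮.r₀ - 1) * 𝒮.C)
    (hC3 : 10 * (1 + 12 * (𝒮.m : ℝ) ^ 2) ≤ q ^ (𝒮.r₀ - 1) * 𝒮.C)
    (hC4 : 20 * (𝒮.m : ℝ) ^ 3 ≤ q ^ (𝒮.r₀ - 1) * 𝒮.C)
    (hCa : 2 * (1 + 11 * (𝒮.m : ℝ) ^ 2) * (𝒮.B 1 + 𝒮.D₀) ≤ 𝒮.C) (hCb : 2 * (𝒮.m : ℝ) ≤ 𝒮.C)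
    (hCc : log (4 * 𝒮.Θ ^ 2) ≤ 𝒮.C) (hCd : 20 * (𝒮.m : ℝ) ^ 3 * 𝒮.D₀ ≤ 𝒮.C)
    (hNbig : 𝒮.R 𝒮.N₀ + log (1 / 𝒮.κ) < q ^ (𝒮.r₀ - 1) * 𝒮.C * 𝒮.τ N / (2 * 𝒮.r₀)) :
    ∃ 𝔓 : Ideal (Rx 𝒮.m), 𝒮.Good (q ^ (𝒮.r₀ - 1)) N 1 𝔓 := by
  have h := 𝒮.good_iter h44 h47 h410 h411 h412 h413 hr₀m hN hq0 hq1 hqc hC1 hC2 hC3 hC4 hCa hCb hCc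
    hCd hNbig (𝒮.r₀ - 1) (by have := 𝒮.one_le_r₀; omega)
  have e : 𝒮.r₀ - (𝒮.r₀ - 1) = 1 := by have := 𝒮.one_le_r₀; omega
  rwa [e] at h

end Setup

end PhilipponMain

end Literature.NumberTheory.Transcendental

end
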